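import Summits.ResolutionOfSingularities.ResolutionOfSingularities.Theorems.EquisingularLiftEquisingularLiftNatIsoHypPointOfPoints
import Summits.ResolutionOfSingularities.ResolutionOfSingularities.Theorems.EquisingularLiftEquisingularLiftNatELNatAtQuadrics
import HarnessLib

/-!
# [OURS] ★★★ ONE-STEP SINGULAR POINTS IN ARBITRARY POSITION — each in its own linear coordinates — ⟹ the lead's hypothesis #7 `IsoHypPoint`
# (cruxes `Theses.EquisingularLift.EquisingularLiftNat` / `…NatThree`, stmt-ResolutionOfSingularities-20038 / -20148)

[OURS · leafhand-res-equisingularlift-10 g0, 2026-08-31; cell `pub/decomp-res`] AI-produced, weaker than expert review; NOT a statement of any manuscript; nothing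
here proves resolution of singularities in positive characteristic.  DEF-FREE helper; no `sorry`; standard axioms; ZERO named hypotheses.

The «exact remaining brick» of ✓ `…NatIsoHypPointOfPoints` (p829346): the intrinsic one-step property of a point of `V₊(F)` read off in ITS OWN linear
coordinate system `g ∈ GL_{m+3}(K)` (the moved equation `F' = linSubst ↑g⁻¹ F` cuts out `α_g(V₊(F))`, ✓ `QuadricELNat.range_comp_projectiveSpaceLinAut`;
`α_g` acts on points by ✓ `QuadricELNat.mem_asHomogeneousIdeal_linAut_hom_iff`):

* `range_hypersurfaceι_setOf` — the binder shape `range ι = {x | F ∈ 𝔮_x}` of `V₊(F)`;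
* ★★ `oneStepAt_of_linAut` — if `F'` carries seat res-D-pv-013's ONE-STEP datum at the vertex `P_c`, every point `x ∈ V₊(F)` with `α_g(ι x) = P_c` is ONE-STEP
  intrinsically («every blow-up of `V₊(F)` at the reduced point `x` is regular over `x`»): `V₊(F) ≅ V₊(F')` over `α_g` (two reduced closed immersions with the same
  image, `IsClosedImmersion.lift`), the vertex point of `V₊(F')` is one-step (✓ `exists_vertexPoint`, ✓ `OneStep.isRegularLocalRing_stalk_of_isBlowup_comap`),
  transport ✓ `PointChain.oneStepAt_of_iso`;
* `exists_linAutPoint` — the point `α_g⁻¹(P_c)` of `V₊(F)`: exists, is unique, is closed with closed image;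
* ★★★ `isoHypPoint_of_oneStepPoints_linAut` — **`F` a prime form over `K = K̄` whose singular points are finitely many ONE-STEP points, each presented in its
  own linear coordinates `(g, c)` (hence ordinary multiple points, `A₂` points, characteristic-2 nodes … ANYWHERE, in ANY NUMBER — e.g. every nodal
  surface, every surface with only `A₁`/`A₂` singularities, once the local data are supplied) ⟹ `IsoHypPoint K (m+2) V₊(F) ι`**, the lead's hypothesis #7
  (= `PointResolvable`; and `ELNatAt` by ✓ `elNatAt_of_isoHypPoint`).  No general-position or `≤ n + 1` proviso (contrast lh7–lh9's one-product engine).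

Remaining for a fully classical statement: «`V₊(F)` regular off the listed points» is taken here as a hypothesis on stalks; for vertex lists it is
✓ `MultiOrd.isRegularLocalRing_stalk_of_forall_exists` (prime-ideal Jacobian form), for arbitrary closed points it needs the closed-point Jacobian dictionary
(Nullstellensatz, ✓ `MultiOrd.hsing_of_jacobian` is vertex-keyed) — S-sized.  Honest label: closes no registered stub.

References: [Hartshorne1977, II Example 7.1.1, I Thm. 5.1]; [StacksProject, Tags 080E, 01J5] — through the cited tree files.
-/

set_option linter.dupNamespace false -- mandated namespace `Summit.<Summit>.<Problem>` of this single-conjunct summit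

noncomputable section

open CategoryTheory CategoryTheory.Limits AlgebraicGeometry TopologicalSpace
open MvPolynomial HomogeneousLocalization
open Literature.AlgebraicGeometry.Resolution Literature.AlgebraicGeometry.Motives Literature.AlgebraicGeometry.GroupSchemes
open Literature.AlgebraicGeometry.Motives.SmoothHypersurface Literature.AlgebraicGeometry.Motives.ProjectiveSpace
open AlgebraicGeometry.Scheme.IdealSheafData
open Summit.ResolutionOfSingularities.ResolutionOfSingularities.Cruxes.EquisingularLift.StrataSplit

namespace Summit.ResolutionOfSingularities.ResolutionOfSingularities.Cruxes.EquisingularLiftNat.Sections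

/-- The binder shape `range ι = {x | F ∈ 𝔮_x}` of the coordinate hypersurface `V₊(F)`. [folklore] -/
theorem range_hypersurfaceι_setOf (K : Type) [Field K] {m : ℕ} (F : MvPolynomial (Fin (m + 2 + 1)) K) :
    letI := MvPolynomial.gradedAlgebra (σ := Fin (m + 2 + 1)) (R := K)
    Set.range (hypersurfaceι F).left = {x : (projectiveSpace (m + 2) K).left | F ∈ x.asHomogeneousIdeal} := by
  letI := MvPolynomial.gradedAlgebra (σ := Fin (m + 2 + 1)) (R := K)
  rw [range_hypersurfaceι]
  ext x
  refine ⟨fun h => ?_, fun h => (ProjectiveSpectrum.mem_zeroLocus _ _ _).mpr (Set.singleton_subset_iff.mpr h)⟩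
  have h' : F ∈ (x.asHomogeneousIdeal : Set (MvPolynomial (Fin (m + 2 + 1)) K)) :=
    Set.singleton_subset_iff.mp ((ProjectiveSpectrum.mem_zeroLocus _ _ _).mp h)
  exact h'

/-- ★★ **ONE-STEP POINTS IN THEIR OWN LINEAR COORDINATES.**  `F` a prime form over `K`, `g ∈ GL_{m+3}(K)`, `c` a coordinate, and
`F' = linSubst ↑g⁻¹ F` (the equation of `α_g(V₊(F))`, ✓ `range_comp_projectiveSpaceLinAut`) a prime form carrying seat res-D-pv-013's ONE-STEP datum at the
vertex `P_c`.  Then every point `x ∈ V₊(F)` with `α_g(ι x) = P_c` (i.e. `linSubst ↑g (x_a) ∈ 𝔮_{ι x}` for `a ≠ c`) is a ONE-STEP point of `V₊(F)` in the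
intrinsic sense: every blow-up of `V₊(F)` at the reduced point `x` is regular at its points over `x`.  Proof: `V₊(F) ≅ V₊(F')` over `α_g` (two reduced closed
immersions with the same image), the vertex point of `V₊(F')` is one-step (✓ `exists_vertexPoint`, ✓ `OneStep.isRegularLocalRing_stalk_of_isBlowup_comap`),
transport ✓ `PointChain.oneStepAt_of_iso`. [OURS] [cite: Hartshorne1977, II Example 7.1.1, I Thm. 5.1] -/
theorem oneStepAt_of_linAut (K : Type) [Field K] {m : ℕ} (F : MvPolynomial (Fin (m + 2 + 1)) K) {d : ℕ} (hF : F.IsHomogeneous d)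
    (hFp : Prime F) (g : GL (Fin (m + 2 + 1)) K) (c : Fin (m + 2 + 1))
    (hF' : (ProjLinAction.linSubst K ((g⁻¹ : GL (Fin (m + 2 + 1)) K) : Matrix (Fin (m + 2 + 1)) (Fin (m + 2 + 1)) K) F).IsHomogeneous d)
    (hF'p : Prime (ProjLinAction.linSubst K ((g⁻¹ : GL (Fin (m + 2 + 1)) K) : Matrix (Fin (m + 2 + 1)) (Fin (m + 2 + 1)) K) F))
    (hone' : ∃ (μ : ℕ) (Φ Ψ : MvPolynomial (Fin (m + 2)) K), 1 ≤ μ ∧ Φ.IsHomogeneous μ ∧ Φ ≠ 0 ∧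
      Ψ ∈ Ideal.span (Set.range (X : Fin (m + 2) → MvPolynomial (Fin (m + 2)) K)) ^ (μ + 1) ∧
      ProjectiveSpace.dehomogenize K c (ProjLinAction.linSubst K ((g⁻¹ : GL (Fin (m + 2 + 1)) K) : Matrix (Fin (m + 2 + 1)) (Fin (m + 2 + 1)) K) F) = Φ + Ψ ∧
      ∀ l : Fin (m + 2), ∃ G : MvPolynomial (Fin (m + 2)) K,
        aeval (fun j => X l * Function.update (X : Fin (m + 2) → MvPolynomial (Fin (m + 2)) K) l 1 j) (Φ + Ψ) = X l ^ μ * G ∧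
        ∀ P : Ideal (MvPolynomial (Fin (m + 2)) K), P.IsPrime → (X l : MvPolynomial (Fin (m + 2)) K) ∈ P → G ∈ P → ∃ j, pderiv j G ∉ P) :
    letI := MvPolynomial.gradedAlgebra (σ := Fin (m + 2 + 1)) (R := K)
    ∀ (x : ↥(hypersurface F).left),
      (∀ a : Fin (m + 2 + 1), a ≠ c → ProjLinAction.linSubst K (g : Matrix (Fin (m + 2 + 1)) (Fin (m + 2 + 1)) K) (X a) ∈ ((hypersurfaceι F).left x).asHomogeneousIdeal) →
      ∀ (hx : IsClosed ({x} : Set ↥(hypersurface F).left)) (Z : Scheme.{0}) (τ : Z ⟶ (hypersurface F).left),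
        IsBlowup τ (vanishingIdeal ⟨{x}, hx⟩) → ∀ z : Z, τ z = x → IsRegularLocalRing (Z.presheaf.stalk z) := by
  letI := MvPolynomial.gradedAlgebra (σ := Fin (m + 2 + 1)) (R := K)
  letI := MvPolynomial.gradedAlgebra (σ := Fin (0 + 1)) (R := K)
  intro x hxv hx Z τ hτ z hz
  set F' := ProjLinAction.linSubst K ((g⁻¹ : GL (Fin (m + 2 + 1)) K) : Matrix (Fin (m + 2 + 1)) (Fin (m + 2 + 1)) K) F with hF'def
  haveI := HypersurfaceSpecimen.isIntegral_hypersurface_of_prime K F hF hFp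
  haveI := HypersurfaceSpecimen.isIntegral_hypersurface_of_prime K F' hF' hF'p
  -- the moved embedding `ι' = ι ≫ α_g` and its range
  set ι' : (hypersurface F).left ⟶ (projectiveSpace (m + 2) K).left :=
    (hypersurfaceι F).left ≫ (ProjLinAction.projectiveSpaceLinAut (m + 2) K g).hom.left with hι'
  haveI : IsClosedImmersion ι' := by rw [hι']; infer_instance
  have hrange' : Set.range ι' = Set.range (hypersurfaceι F').left := by
    rw [hι', QuadricELNat.range_comp_projectiveSpaceLinAut g _ F (range_hypersurfaceι_setOf K F), range_hypersurfaceι_setOf K F']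
  -- `V₊(F) ≅ V₊(F')` compatibly with `ι'` and `ι_{F'}`
  have hker : (hypersurfaceι F').left.ker = ι'.ker := by
    have h1 : vanishingIdeal (⟨closure (Set.range (hypersurfaceι F').left), isClosed_closure⟩ : Closeds _) = (hypersurfaceι F').left.ker := by
      rw [← Scheme.IdealSheafData.map_bot, ← Scheme.nilradical_eq_bot, ← Scheme.IdealSheafData.vanishingIdeal_top,
        Scheme.IdealSheafData.map_vanishingIdeal]
      congr 1; ext1
      change closure (Set.range _) = closure (_ '' Set.univ); rw [Set.image_univ]
    have h2 : vanishingIdeal (⟨closure (Set.range ι'), isClosed_closure⟩ : Closeds _) = ι'.ker := by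
      rw [← Scheme.IdealSheafData.map_bot, ← Scheme.nilradical_eq_bot, ← Scheme.IdealSheafData.vanishingIdeal_top,
        Scheme.IdealSheafData.map_vanishingIdeal]
      congr 1; ext1
      change closure (Set.range _) = closure (_ '' Set.univ); rw [Set.image_univ]
    rw [← h1, ← h2]
    congr 2
    rw [hrange']
  let e : (hypersurface F).left ⟶ (hypersurface F').left := IsClosedImmersion.lift (hypersurfaceι F').left ι' hker.le
  have he : e ≫ (hypersurfaceι F').left = ι' := IsClosedImmersion.lift_fac _ _ hker.le
  haveI : IsIso e := IsClosedImmersion.isIso_lift _ _ hker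
  -- the vertex point of `V₊(F')`
  have hec : ∀ j : Fin 1, (fun _ : Fin 1 => c) j = c := fun _ => rfl
  have hinj1 : Function.Injective (fun _ : Fin 1 => c) := Function.injective_of_subsingleton _
  obtain ⟨fk, hfk', hfkC, hfke, hfk0⟩ := LinearCentre.exists_kill (R := K) (fun _ : Fin 1 => c) hinj1
  have hfke' : ∀ j : Fin 1, fk (X c) = X j := fun j => hfke j
  have hfk0' : ∀ i : Fin (m + 2 + 1), i ≠ c → fk (X i) = 0 := fun i hi => hfk0 i (fun ⟨_, hj⟩ => hi hj.symm)
  obtain ⟨μ, Φ, Ψ, hμ, hΦ, hΦ0, hΨ, hdeh, hG⟩ := hone'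
  obtain ⟨x₀, hx₀cl, hx₀cl', hsupp, -, -, hcomap⟩ :=
    exists_vertexPoint K F' hF' c ⟨μ, Φ, Ψ, hμ, hΦ, hΨ, hdeh⟩ fk hfk' hfkC hfke' hfk0'
  -- `e x = x₀`: both map to the vertex point of `ℙ`
  have hex : e x = x₀ := by
    apply (hypersurfaceι F').left.isClosedEmbedding.injective
    have h1 : (hypersurfaceι F').left (e x) = ι' x := by rw [← Scheme.Hom.comp_apply, he]
    have hmem : ι' x ∈ ((Proj.map fk hfk').ker.support : Set (Proj (homogeneousSubmodule (Fin (m + 2 + 1)) K))) := by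
      rw [LinearCentre.support_ker_eq_zeroLocus (fun _ : Fin 1 => c) hinj1 fk hfk' hfkC hfke hfk0]
      intro a ha
      have ha' : a ≠ c := fun h => ha ⟨0, h.symm⟩
      rw [hι', Scheme.Hom.comp_apply]
      exact (QuadricELNat.mem_asHomogeneousIdeal_linAut_hom_iff g _ (X a)).mpr (hxv a ha')
    rw [hsupp] at hmem
    rw [h1]
    exact Set.mem_singleton_iff.mp hmem
  -- the vertex point of `V₊(F')` is one-step (pointwise, seat res-D-pv-013)
  have hone₀ : ∀ (B : Scheme.{0}) (π : B ⟶ (hypersurface F').left), IsBlowup π (vanishingIdeal ⟨{x₀}, hx₀cl'⟩) →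
      ∀ b : B, π b = x₀ → IsRegularLocalRing (B.presheaf.stalk b) := by
    intro B π hπ b hb
    rw [← hcomap] at hπ
    refine OneStep.isRegularLocalRing_stalk_of_isBlowup_comap K F' c hF' hF'p hec fk hfk' hfkC hfke hfk0 Φ Ψ hΦ hμ hΦ0 hΨ hdeh hG hπ b ?_
    have hgoal : (hypersurfaceι F').left (π b) ∈ ((Proj.map fk hfk').ker.support : Set (Proj (homogeneousSubmodule (Fin (m + 2 + 1)) K))) := by
      rw [hb, hsupp]; rfl
    rw [Scheme.IdealSheafData.support_comap]
    exact hgoal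
  -- transport along `e⁻¹`
  have hsymm : (asIso e).symm.hom x₀ = x := by
    rw [← hex]
    change (e ≫ inv e) x = x
    rw [IsIso.hom_inv_id]; rfl
  have hxcl' : IsClosed ({(asIso e).symm.hom x₀} : Set ↥(hypersurface F).left) := by rw [hsymm]; exact hx
  have key := PointChain.oneStepAt_of_iso (asIso e).symm hx₀cl' hone₀ hxcl'
  have hC : (⟨{(asIso e).symm.hom x₀}, hxcl'⟩ : Closeds ↥(hypersurface F).left) = ⟨{x}, hx⟩ := Closeds.ext (by
    change ({(asIso e).symm.hom x₀} : Set ↥(hypersurface F).left) = {x}; rw [hsymm])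
  rw [hC] at key
  exact key Z τ hτ z (by rw [hz, hsymm])


/-- **The point of `V₊(F)` over the vertex `P_c` of the coordinates `g`** (`α_g(ι x) = P_c`): it exists as soon as the moved equation `F' = linSubst ↑g⁻¹ F`
splits at `P_c` (`μ ≥ 1`), it is unique, and it is a closed point with closed image. [OURS] [folklore] -/
theorem exists_linAutPoint (K : Type) [Field K] {m : ℕ} (F : MvPolynomial (Fin (m + 2 + 1)) K) {d : ℕ}
    (g : GL (Fin (m + 2 + 1)) K) (c : Fin (m + 2 + 1))
    (hF' : (ProjLinAction.linSubst K ((g⁻¹ : GL (Fin (m + 2 + 1)) K) : Matrix (Fin (m + 2 + 1)) (Fin (m + 2 + 1)) K) F).IsHomogeneous d)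
    (hsplit : ∃ (μ : ℕ) (Φ Ψ : MvPolynomial (Fin (m + 2)) K), 1 ≤ μ ∧ Φ.IsHomogeneous μ ∧
      Ψ ∈ Ideal.span (Set.range (X : Fin (m + 2) → MvPolynomial (Fin (m + 2)) K)) ^ (μ + 1) ∧
      ProjectiveSpace.dehomogenize K c (ProjLinAction.linSubst K ((g⁻¹ : GL (Fin (m + 2 + 1)) K) : Matrix (Fin (m + 2 + 1)) (Fin (m + 2 + 1)) K) F) = Φ + Ψ) :
    letI := MvPolynomial.gradedAlgebra (σ := Fin (m + 2 + 1)) (R := K)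
    ∃ x : ↥(hypersurface F).left,
      (∀ a : Fin (m + 2 + 1), a ≠ c → ProjLinAction.linSubst K (g : Matrix (Fin (m + 2 + 1)) (Fin (m + 2 + 1)) K) (X a) ∈ ((hypersurfaceι F).left x).asHomogeneousIdeal) ∧
      (∀ x' : ↥(hypersurface F).left, (∀ a : Fin (m + 2 + 1), a ≠ c →
        ProjLinAction.linSubst K (g : Matrix (Fin (m + 2 + 1)) (Fin (m + 2 + 1)) K) (X a) ∈ ((hypersurfaceι F).left x').asHomogeneousIdeal) → x' = x) ∧
      IsClosed ({(hypersurfaceι F).left x} : Set (projectiveSpace (m + 2) K).left) ∧ IsClosed ({x} : Set ↥(hypersurface F).left) := by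
  letI := MvPolynomial.gradedAlgebra (σ := Fin (m + 2 + 1)) (R := K)
  letI := MvPolynomial.gradedAlgebra (σ := Fin (0 + 1)) (R := K)
  set F' := ProjLinAction.linSubst K ((g⁻¹ : GL (Fin (m + 2 + 1)) K) : Matrix (Fin (m + 2 + 1)) (Fin (m + 2 + 1)) K) F with hF'def
  have hιinj : Function.Injective (hypersurfaceι F).left := (hypersurfaceι F).left.isClosedEmbedding.injective
  set α := (ProjLinAction.projectiveSpaceLinAut (m + 2) K g).hom.left with hα
  have hαinj : Function.Injective α := by
    rw [hα]
    exact (Scheme.homeoOfIso (asIso (ProjLinAction.projectiveSpaceLinAut (m + 2) K g).hom.left)).injective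
  have hinj1 : Function.Injective (fun _ : Fin 1 => c) := Function.injective_of_subsingleton _
  obtain ⟨fk, hfk', hfkC, hfke, hfk0⟩ := LinearCentre.exists_kill (R := K) (fun _ : Fin 1 => c) hinj1
  have hfke' : ∀ j : Fin 1, fk (X c) = X j := fun j => hfke j
  have hfk0' : ∀ i : Fin (m + 2 + 1), i ≠ c → fk (X i) = 0 := fun i hi => hfk0 i (fun ⟨_, hj⟩ => hi hj.symm)
  obtain ⟨x₀, hx₀cl, -, hsupp, hx₀X, -, -⟩ := exists_vertexPoint K F' hF' c hsplit fk hfk' hfkC hfke' hfk0'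
  -- membership in the vertex support ⟺ the transported vertex condition
  have hmem_iff : ∀ y : (projectiveSpace (m + 2) K).left,
      α y ∈ ((Proj.map fk hfk').ker.support : Set (Proj (homogeneousSubmodule (Fin (m + 2 + 1)) K))) ↔
      ∀ a : Fin (m + 2 + 1), a ≠ c → ProjLinAction.linSubst K (g : Matrix (Fin (m + 2 + 1)) (Fin (m + 2 + 1)) K) (X a) ∈ y.asHomogeneousIdeal := by
    intro y
    rw [LinearCentre.support_ker_eq_zeroLocus (fun _ : Fin 1 => c) hinj1 fk hfk' hfkC hfke hfk0]
    constructor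
    · intro h a ha
      exact (QuadricELNat.mem_asHomogeneousIdeal_linAut_hom_iff g y (X a)).mp (h a (fun ⟨_, hj⟩ => ha hj.symm))
    · intro h a ha
      exact (QuadricELNat.mem_asHomogeneousIdeal_linAut_hom_iff g y (X a)).mpr (h a (fun h' => ha ⟨0, h'.symm⟩))
  -- the vertex point of `V₊(F')` comes from a point of `V₊(F)`
  have hrange' : Set.range ((hypersurfaceι F).left ≫ α) = Set.range (hypersurfaceι F').left := by
    rw [hα, QuadricELNat.range_comp_projectiveSpaceLinAut g _ F (range_hypersurfaceι_setOf K F), range_hypersurfaceι_setOf K F']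
  obtain ⟨x, hx⟩ : (hypersurfaceι F').left x₀ ∈ Set.range ((hypersurfaceι F).left ≫ α) := by rw [hrange']; exact ⟨x₀, rfl⟩
  rw [Scheme.Hom.comp_apply] at hx
  have hxv : ∀ a : Fin (m + 2 + 1), a ≠ c →
      ProjLinAction.linSubst K (g : Matrix (Fin (m + 2 + 1)) (Fin (m + 2 + 1)) K) (X a) ∈ ((hypersurfaceι F).left x).asHomogeneousIdeal := by
    rw [← hmem_iff, hx, hsupp]; rfl
  refine ⟨x, hxv, fun x' hx' => ?_, ?_, ?_⟩
  · apply hιinj; apply hαinj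
    have h1 := (hmem_iff _).mpr hx'
    rw [hsupp] at h1
    rw [hx, Set.mem_singleton_iff.mp h1]
  · refine PointChain.isClosed_singleton_of_injective α hαinj ?_
    rw [hx]; exact hx₀cl
  · refine PointChain.isClosed_singleton_of_injective (hypersurfaceι F).left hιinj (PointChain.isClosed_singleton_of_injective α hαinj ?_)
    rw [hx]; exact hx₀cl

/-- ★★★ **ONE-STEP SINGULAR POINTS IN ARBITRARY POSITION, EACH IN ITS OWN LINEAR COORDINATES ⟹ `IsoHypPoint`** — every dimension, every characteristic,
any number of points.  `K` algebraically closed; `F` a prime form; `pts` a list of coordinate data `(g, c)` — the point is `α_g⁻¹(P_c)`, i.e. the point `x` of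
`V₊(F)` with `linSubst ↑g (x_a) ∈ 𝔮_{ι x}` for `a ≠ c` — such that for each `(g, c)` the moved equation `F' = linSubst ↑g⁻¹ F` is a prime form of degree `d`
carrying seat res-D-pv-013's ONE-STEP datum at the vertex `P_c` and `V₊(F)` is non-regular at that point; and `V₊(F)` is regular at every point which is none of
these.  Then `IsoHypPoint K (m+2) V₊(F) ι` — the lead's hypothesis #7 (= `PointResolvable`), with NO general-position or cardinality proviso
(✓ `isoHypPoint_of_oneStepPoints` + `oneStepAt_of_linAut`). [OURS] [cite: Hartshorne1977, II Example 7.1.1, I Thm. 5.1] [cite: StacksProject, Tag 080E] -/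
theorem isoHypPoint_of_oneStepPoints_linAut (K : Type) [Field K] [IsAlgClosed K] {m : ℕ} (F : MvPolynomial (Fin (m + 2 + 1)) K) {d : ℕ}
    (hF : F.IsHomogeneous d) (hFp : Prime F) (pts : List (GL (Fin (m + 2 + 1)) K × Fin (m + 2 + 1)))
    (hone : ∀ gc ∈ pts,
      (ProjLinAction.linSubst K ((gc.1⁻¹ : GL (Fin (m + 2 + 1)) K) : Matrix (Fin (m + 2 + 1)) (Fin (m + 2 + 1)) K) F).IsHomogeneous d ∧
      Prime (ProjLinAction.linSubst K ((gc.1⁻¹ : GL (Fin (m + 2 + 1)) K) : Matrix (Fin (m + 2 + 1)) (Fin (m + 2 + 1)) K) F) ∧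
      ∃ (μ : ℕ) (Φ Ψ : MvPolynomial (Fin (m + 2)) K), 1 ≤ μ ∧ Φ.IsHomogeneous μ ∧ Φ ≠ 0 ∧
        Ψ ∈ Ideal.span (Set.range (X : Fin (m + 2) → MvPolynomial (Fin (m + 2)) K)) ^ (μ + 1) ∧
        ProjectiveSpace.dehomogenize K gc.2 (ProjLinAction.linSubst K ((gc.1⁻¹ : GL (Fin (m + 2 + 1)) K) :
          Matrix (Fin (m + 2 + 1)) (Fin (m + 2 + 1)) K) F) = Φ + Ψ ∧
        ∀ l : Fin (m + 2), ∃ G : MvPolynomial (Fin (m + 2)) K,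
          aeval (fun j => X l * Function.update (X : Fin (m + 2) → MvPolynomial (Fin (m + 2)) K) l 1 j) (Φ + Ψ) = X l ^ μ * G ∧
          ∀ P : Ideal (MvPolynomial (Fin (m + 2)) K), P.IsPrime → (X l : MvPolynomial (Fin (m + 2)) K) ∈ P → G ∈ P → ∃ j, pderiv j G ∉ P)
    (hsingpt : letI := MvPolynomial.gradedAlgebra (σ := Fin (m + 2 + 1)) (R := K)
      ∀ gc ∈ pts, ∀ x : ↥(hypersurface F).left, (∀ a : Fin (m + 2 + 1), a ≠ gc.2 →
        ProjLinAction.linSubst K (gc.1 : Matrix (Fin (m + 2 + 1)) (Fin (m + 2 + 1)) K) (X a) ∈ ((hypersurfaceι F).left x).asHomogeneousIdeal) →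
        ¬ IsRegularLocalRing ((hypersurface F).left.presheaf.stalk x))
    (hreg : letI := MvPolynomial.gradedAlgebra (σ := Fin (m + 2 + 1)) (R := K)
      ∀ x : ↥(hypersurface F).left, (∀ gc ∈ pts, ¬ (∀ a : Fin (m + 2 + 1), a ≠ gc.2 →
        ProjLinAction.linSubst K (gc.1 : Matrix (Fin (m + 2 + 1)) (Fin (m + 2 + 1)) K) (X a) ∈ ((hypersurfaceι F).left x).asHomogeneousIdeal)) →
        IsRegularLocalRing ((hypersurface F).left.presheaf.stalk x)) :
    letI := MvPolynomial.gradedAlgebra (σ := Fin (m + 2 + 1)) (R := K)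
    IsoHypPoint K (m + 2) (hypersurface F).left (hypersurfaceι F).left := by
  letI := MvPolynomial.gradedAlgebra (σ := Fin (m + 2 + 1)) (R := K)
  classical
  haveI := HypersurfaceSpecimen.isIntegral_hypersurface_of_prime K F hF hFp
  have hιinj : Function.Injective (hypersurfaceι F).left := (hypersurfaceι F).left.isClosedEmbedding.injective
  -- the points
  have hpt : ∀ gc, gc ∈ pts → ∃ x : ↥(hypersurface F).left,
      (∀ a : Fin (m + 2 + 1), a ≠ gc.2 → ProjLinAction.linSubst K (gc.1 : Matrix (Fin (m + 2 + 1)) (Fin (m + 2 + 1)) K) (X a) ∈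
        ((hypersurfaceι F).left x).asHomogeneousIdeal) ∧
      (∀ x' : ↥(hypersurface F).left, (∀ a : Fin (m + 2 + 1), a ≠ gc.2 →
        ProjLinAction.linSubst K (gc.1 : Matrix (Fin (m + 2 + 1)) (Fin (m + 2 + 1)) K) (X a) ∈ ((hypersurfaceι F).left x').asHomogeneousIdeal) → x' = x) ∧
      IsClosed ({(hypersurfaceι F).left x} : Set (projectiveSpace (m + 2) K).left) ∧ IsClosed ({x} : Set ↥(hypersurface F).left) := by
    intro gc hgc
    obtain ⟨hF', -, μ, Φ, Ψ, hμ, hΦ, -, hΨ, hdeh, -⟩ := hone gc hgc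
    exact exists_linAutPoint K F gc.1 gc.2 hF' ⟨μ, Φ, Ψ, hμ, hΦ, hΨ, hdeh⟩
  choose xpt hxv hxuniq hxcl hxcl' using hpt
  let SH : Finset ↥(hypersurface F).left := pts.toFinset.attach.image (fun gc => xpt gc.1 (List.mem_toFinset.mp gc.2))
  have hmemSH : ∀ x, x ∈ SH → ∃ (gc : GL (Fin (m + 2 + 1)) K × Fin (m + 2 + 1)) (hgc : gc ∈ pts), xpt gc hgc = x := fun x hx => by
    obtain ⟨gc, -, h⟩ := Finset.mem_image.mp hx
    exact ⟨gc.1, List.mem_toFinset.mp gc.2, h⟩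
  have hmemSH' : ∀ gc (hgc : gc ∈ pts), xpt gc hgc ∈ SH := fun gc hgc =>
    Finset.mem_image.mpr ⟨⟨gc, List.mem_toFinset.mpr hgc⟩, Finset.mem_attach _ _, rfl⟩
  -- the generic point
  obtain ⟨ξ, hξ⟩ : ∃ ξ : ↥(hypersurface F).left, (hypersurfaceι F).left ξ = pointOfPrime F hF hFp := by
    have h : (pointOfPrime F hF hFp : Proj (homogeneousSubmodule (Fin (m + 2 + 1)) K)) ∈ Set.range (hypersurfaceι F).left := by
      refine (Set.ext_iff.mp (range_hypersurfaceι F) _).mpr ((ProjectiveSpectrum.mem_zeroLocus _ _ _).mpr (Set.singleton_subset_iff.mpr ?_))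
      exact Ideal.subset_span rfl
    exact h
  refine isoHypPoint_of_oneStepPoints K (m + 2) (hypersurface F).left (hypersurfaceι F).left SH ?_ ?_ ?_ ?_ ξ ?_
  · intro x hx
    obtain ⟨gc, hgc, rfl⟩ := hmemSH x hx
    exact hxcl gc hgc
  · intro x hx
    obtain ⟨gc, hgc, rfl⟩ := hmemSH x hx
    exact hsingpt gc hgc _ (hxv gc hgc)
  · intro x hx
    refine hreg x fun gc hgc h => hx ?_
    rw [hxuniq gc hgc x h]
    exact hmemSH' gc hgc
  · intro x hx hxcl₀ Z τ hτ z hz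
    obtain ⟨gc, hgc, rfl⟩ := hmemSH x hx
    obtain ⟨hF', hF'p, hone'⟩ := hone gc hgc
    exact oneStepAt_of_linAut K F hF hFp gc.1 gc.2 hF' hF'p hone' _ (hxv gc hgc) hxcl₀ Z τ hτ z hz
  · -- the generic point is none of the points
    intro x hx h
    obtain ⟨gc, hgc, rfl⟩ := hmemSH x hx
    obtain ⟨-, hF'p, -⟩ := hone gc hgc
    obtain ⟨a, hac, ha⟩ := MultiOrd.exists_X_ne_not_mem_span K
      (ProjLinAction.linSubst K ((gc.1⁻¹ : GL (Fin (m + 2 + 1)) K) : Matrix (Fin (m + 2 + 1)) (Fin (m + 2 + 1)) K) F) hF'p gc.2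
    apply ha
    have h1 := hxv gc hgc a hac
    rw [h, hξ] at h1
    change ProjLinAction.linSubst K (gc.1 : Matrix (Fin (m + 2 + 1)) (Fin (m + 2 + 1)) K) (X a) ∈ Ideal.span {F} at h1
    obtain ⟨r, hr⟩ := Ideal.mem_span_singleton'.mp h1
    have h2 := congrArg (ProjLinAction.linSubst K ((gc.1⁻¹ : GL (Fin (m + 2 + 1)) K) : Matrix (Fin (m + 2 + 1)) (Fin (m + 2 + 1)) K)) hr
    rw [map_mul] at h2
    have h3 : ProjLinAction.linSubst K ((gc.1⁻¹ : GL (Fin (m + 2 + 1)) K) : Matrix (Fin (m + 2 + 1)) (Fin (m + 2 + 1)) K)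
        (ProjLinAction.linSubst K (gc.1 : Matrix (Fin (m + 2 + 1)) (Fin (m + 2 + 1)) K) (X a)) = X a := by
      have h := QuadricELNat.linSubst_linSubst_inv gc.1⁻¹ (X a : MvPolynomial (Fin (m + 2 + 1)) K)
      rwa [inv_inv] at h
    rw [h3] at h2
    exact Ideal.mem_span_singleton'.mpr ⟨_, h2⟩

end Summit.ResolutionOfSingularities.ResolutionOfSingularities.Cruxes.EquisingularLiftNat.Sections

end
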